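import Summits.Ventures.HodgeRepro2.FaceData
import Summits.Ventures.HodgeRepro2.Signs

/-!
# T5DatumCMField — Lemma N.2's sign statement on the CM field itself (Tier-5 sub-step N2)

route/T5-N2-route-3.md, N2.1(b) LEMMA N.2: «With `e₁₁₁, e₁₀₀` μ-admissible for the types
`111, 100` and `u ∈ F^{+×}` with signs `(+,−,+)`: `e₁₀₁ := u·e₁₁₁, e₁₁₀ := u⁻¹·e₁₀₀` are
μ-admissible for `101, 110`; `e₁₀₁e₁₁₀ = e₁₁₁e₁₀₀` exactly».  `T5DatumSimilitude` records this
in a sign-vector model; THIS file records it on the CM number field, in p1's vocabulary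
(`IsCMType`, `IsLiuSignElement` = the sign side of Liu's Def. 4.12 for a representative
`e ∈ E^{×,−}`: `star e = -e ∧ e ≠ 0 ∧ ∀ τ' ∈ Φ, Im τ'(e) < 0`), with Mathlib's
`NumberField.IsCMField` (`star` = the complex conjugation `complexConj K`, which every complex
embedding intertwines with `conj`) and p2's weak-approximation lemma `exists_re_sign_prescribed`:

* `isLiuSignElement_mul_of_sign`: if `e` is admissible for the CM type `Φ` and `u` is a
  totally real element (`star u = u`, `u ≠ 0`) whose sign at every embedding `τ` is `+` exactly
  when `Φ` and `Φ'` AGREE at `τ`, then `u e` is admissible for `Φ'`;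
* `exists_real_of_cmTypes`: for ANY two CM types `Φ, Φ'` such a `u` exists (weak
  approximation on the complex places of `K`: `u = x + star x` with `Re τ(x)` of prescribed
  sign at each place);
* `exists_mul_isLiuSignElement`: hence for any two CM types `Φ, Φ'` and any admissible `e`
  for `Φ` there is a totally real `u` with `u e` admissible for `Φ'` — negative exactly where
  the two types differ;
* **`lemma_N2`**: Lemma N.2 in full — two pairs `(Φ₁, Φ₁')`, `(Φ₂, Φ₂')` of CM types with the
  SAME flip pattern (`SameFlip`: `Φ₁` and `Φ₁'` differ at `τ` iff `Φ₂` and `Φ₂'` do — the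
  `111 xor 101 = 100 xor 110` of the datum) and admissible `e₁, e₂` give ONE totally real `u`
  with `u e₁` admissible for `Φ₁'`, `u⁻¹ e₂` admissible for `Φ₂'`, and
  `(u e₁)(u⁻¹ e₂) = e₁ e₂` exactly.

Nothing here is about hermitian spaces, similitudes or the Shimura datum: it is the existence
and sign bookkeeping of the datum's `u`, `e₁₀₁`, `e₁₁₀` on the field.  The vertex types
`111, 100, 101, 110` themselves are the record's (`T5DatumSimilitude` checks their flip
pattern).  No Literature fact is asserted.
-/

namespace Summit.Ventures.HodgeRepro2.T5DatumCMField

open NumberField NumberField.ComplexEmbedding Complex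
open scoped ComplexConjugate

variable {K : Type*} [Field K] [NumberField K] [IsCMField K]

/-! ## 1. Totally real elements and complex embeddings -/

/-- `star` on a CM field is Mathlib's `complexConj`. -/
theorem star_eq_complexConj (u : K) : star u = IsCMField.complexConj K u := rfl

/-- Every complex embedding intertwines `star` with `conj`. -/
theorem embedding_star (τ : K →+* ℂ) (x : K) : τ (star x) = conj (τ x) := by
  rw [star_eq_complexConj]
  exact IsCMField.complexEmbedding_complexConj K τ x

/-- A totally real element (`star u = u`) has real image under every embedding. -/
theorem im_eq_zero_of_star_eq {u : K} (hu : star u = u) (τ : K →+* ℂ) : (τ u).im = 0 := by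
  have h : conj (τ u) = τ u := by rw [← embedding_star, hu]
  exact Complex.conj_eq_iff_im.mp h

/-- …and non-zero real part when `u ≠ 0`. -/
theorem re_ne_zero_of_star_eq {u : K} (hu : star u = u) (hu0 : u ≠ 0) (τ : K →+* ℂ) :
    (τ u).re ≠ 0 := by
  intro h
  apply hu0
  apply τ.injective
  rw [map_zero]
  exact Complex.ext h (im_eq_zero_of_star_eq hu τ)

/-- The imaginary part of `τ(u e)` for a totally real `u` is `Re τ(u) · Im τ(e)`. -/
theorem im_mul_of_star_eq {u : K} (hu : star u = u) (τ : K →+* ℂ) (e : K) :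
    (τ (u * e)).im = (τ u).re * (τ e).im := by
  rw [map_mul, Complex.mul_im, im_eq_zero_of_star_eq hu τ, zero_mul, add_zero]

/-- The sign of `Re τ(u⁻¹)` is the sign of `Re τ(u)` for a totally real `u ≠ 0`. -/
theorem pos_re_inv_iff {u : K} (hu : star u = u) (hu0 : u ≠ 0) (τ : K →+* ℂ) :
    0 < (τ u⁻¹).re ↔ 0 < (τ u).re := by
  rw [map_inv₀, Complex.inv_re, Complex.normSq_apply, im_eq_zero_of_star_eq hu τ, mul_zero,
    add_zero]
  have hne := re_ne_zero_of_star_eq hu hu0 τ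
  have hpos : 0 < (τ u).re * (τ u).re := mul_self_pos.mpr hne
  constructor
  · intro h
    exact (div_pos_iff_of_pos_right hpos).mp h
  · intro h
    exact div_pos h hpos

/-- `star u⁻¹ = u⁻¹` for a totally real `u`. -/
theorem star_inv_of_star_eq {u : K} (hu : star u = u) : star u⁻¹ = u⁻¹ := by
  rw [star_inv₀, hu]

omit [NumberField K] [IsCMField K] in
/-- The imaginary parts at conjugate embeddings are opposite. -/
theorem im_conjugate (τ : K →+* ℂ) (e : K) : (conjugate τ e).im = -(τ e).im := by
  rw [conjugate_coe_eq, Complex.conj_im]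

omit [NumberField K] [IsCMField K] in
/-- The real parts at conjugate embeddings agree. -/
theorem re_conjugate (τ : K →+* ℂ) (e : K) : (conjugate τ e).re = (τ e).re := by
  rw [conjugate_coe_eq, Complex.conj_re]

omit [NumberField K] [IsCMField K] in
/-- `conjugate` is an involution. -/
theorem conjugate_conjugate (τ : K →+* ℂ) : conjugate (conjugate τ) = τ := by
  ext x
  rw [conjugate_coe_eq, conjugate_coe_eq, Complex.conj_conj]

/-! ## 2. CM types: agreement at `τ` and at `conjugate τ` -/

omit [NumberField K] [IsCMField K] in
/-- For a CM type, `τ ∉ Φ ↔ conjugate τ ∈ Φ`. -/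
theorem not_mem_iff_conjugate_mem {Φ : Set (K →+* ℂ)} (hΦ : IsCMType K Φ) (τ : K →+* ℂ) :
    τ ∉ Φ ↔ conjugate τ ∈ Φ := by
  have h := hΦ τ
  rw [xor_iff_not_iff] at h
  constructor
  · intro hτ
    by_contra hc
    exact h (iff_of_false hτ hc)
  · intro hc hτ
    exact h (iff_of_true hτ hc)

omit [NumberField K] [IsCMField K] in
/-- Two CM types agree at `τ` iff they agree at `conjugate τ`. -/
theorem agree_conjugate_iff {Φ Φ' : Set (K →+* ℂ)} (hΦ : IsCMType K Φ) (hΦ' : IsCMType K Φ')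
    (τ : K →+* ℂ) : (conjugate τ ∈ Φ ↔ conjugate τ ∈ Φ') ↔ (τ ∈ Φ ↔ τ ∈ Φ') := by
  rw [← not_mem_iff_conjugate_mem hΦ, ← not_mem_iff_conjugate_mem hΦ']
  exact not_iff_not

/-! ## 3. Admissibility transported by a totally real element -/

/-- **The transport lemma.** If `e` is admissible for `Φ`, `u` is totally real and non-zero,
and `Re τ(u) > 0` exactly when `Φ` and `Φ'` agree at `τ`, then `u e` is admissible for `Φ'`. -/
theorem isLiuSignElement_mul_of_sign {Φ Φ' : Set (K →+* ℂ)} (hΦ : IsCMType K Φ)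
    {e u : K} (he : IsLiuSignElement K Φ e) (hu : star u = u) (hu0 : u ≠ 0)
    (hsign : ∀ τ : K →+* ℂ, 0 < (τ u).re ↔ (τ ∈ Φ ↔ τ ∈ Φ')) :
    IsLiuSignElement K Φ' (u * e) := by
  obtain ⟨he1, he2, he3⟩ := he
  refine ⟨?_, mul_ne_zero hu0 he2, ?_⟩
  · rw [star_mul', hu, he1, mul_neg]
  · intro τ hτ
    rw [im_mul_of_star_eq hu]
    by_cases hτΦ : τ ∈ Φ
    · have hpos : 0 < (τ u).re := (hsign τ).mpr (iff_of_true hτΦ hτ)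
      exact mul_neg_of_pos_of_neg hpos (he3 τ hτΦ)
    · have hneg : (τ u).re < 0 := by
        have hne := re_ne_zero_of_star_eq hu hu0 τ
        have hnp : ¬ 0 < (τ u).re := fun h => hτΦ (((hsign τ).mp h).mpr hτ)
        exact lt_of_le_of_ne (not_lt.mp hnp) hne
      have hc : conjugate τ ∈ Φ := (not_mem_iff_conjugate_mem hΦ τ).mp hτΦ
      have him : 0 < (τ e).im := by
        have := he3 (conjugate τ) hc
        rw [im_conjugate] at this
        linarith
      exact mul_neg_of_neg_of_pos hneg him

/-! ## 4. Existence of the totally real element with the prescribed signs -/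

/-- The sign prescription on the complex places of `K` attached to two CM types: `+` at the
place `w` iff `Φ` and `Φ'` agree at (an embedding above) `w`. -/
noncomputable def agreeSign (Φ Φ' : Set (K →+* ℂ)) (w : InfinitePlace K) : Bool :=
  by classical exact decide (∃ τ : K →+* ℂ, InfinitePlace.mk τ = w ∧ (τ ∈ Φ ↔ τ ∈ Φ'))

omit [IsCMField K] in
/-- For CM types the prescription is read off at any embedding above the place. -/
theorem agreeSign_mk {Φ Φ' : Set (K →+* ℂ)} (hΦ : IsCMType K Φ) (hΦ' : IsCMType K Φ')
    (τ : K →+* ℂ) : agreeSign Φ Φ' (InfinitePlace.mk τ) = true ↔ (τ ∈ Φ ↔ τ ∈ Φ') := by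
  classical
  unfold agreeSign
  rw [decide_eq_true_iff]
  constructor
  · rintro ⟨τ', hτ', hagree⟩
    rcases InfinitePlace.mk_eq_iff.mp hτ' with h | h
    · rwa [h] at hagree
    · subst h
      exact (agree_conjugate_iff hΦ hΦ' τ').mpr hagree
  · intro h
    exact ⟨τ, rfl, h⟩

omit [NumberField K] [IsCMField K] in
/-- The real part of `τ(x)` is the real part of `x` at the place of `τ`. -/
theorem re_embedding_mk (τ : K →+* ℂ) (x : K) :
    ((InfinitePlace.mk τ).embedding x).re = (τ x).re := by
  rcases InfinitePlace.embedding_mk_eq τ with h | h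
  · rw [h]
  · rw [h, re_conjugate]

/-- **Weak approximation, CM form:** for any two CM types there is a totally real `u ≠ 0`
whose sign at `τ` is `+` exactly when the types agree at `τ`.  (`u = x + star x` with
`Re τ(x)` of the prescribed sign at every complex place of `K`, by p2's
`exists_re_sign_prescribed`.) -/
theorem exists_real_of_cmTypes {Φ Φ' : Set (K →+* ℂ)} (hΦ : IsCMType K Φ)
    (hΦ' : IsCMType K Φ') :
    ∃ u : K, star u = u ∧ u ≠ 0 ∧ ∀ τ : K →+* ℂ, (0 < (τ u).re ↔ (τ ∈ Φ ↔ τ ∈ Φ')) := by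
  obtain ⟨x, hx⟩ := ShimuraData.exists_re_sign_prescribed K (agreeSign Φ Φ')
  refine ⟨x + star x, ?_, ?_, ?_⟩
  · rw [star_add, star_star, add_comm]
  · intro h0
    obtain ⟨τ⟩ := (inferInstance : Nonempty (K →+* ℂ))
    have h1 := (hx (InfinitePlace.mk τ)).2
    rw [re_embedding_mk] at h1
    apply h1
    have h2 : τ (x + star x) = 0 := by rw [h0, map_zero]
    rw [map_add, embedding_star] at h2
    have h3 := congrArg Complex.re h2
    rw [Complex.add_re, Complex.conj_re, Complex.zero_re] at h3
    linarith
  · intro τ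
    have h1 := hx (InfinitePlace.mk τ)
    rw [re_embedding_mk, agreeSign_mk hΦ hΦ'] at h1
    rw [map_add, embedding_star, Complex.add_re, Complex.conj_re]
    constructor
    · intro h
      exact h1.1.mp (by linarith)
    · intro h
      have := h1.1.mpr h
      linarith

/-- **Admissibility for any other CM type by a totally real factor:** for CM types `Φ, Φ'`
and `e` admissible for `Φ` there is a totally real `u ≠ 0` with `u e` admissible for `Φ'`,
negative exactly where `Φ` and `Φ'` differ. -/
theorem exists_mul_isLiuSignElement {Φ Φ' : Set (K →+* ℂ)} (hΦ : IsCMType K Φ)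
    (hΦ' : IsCMType K Φ') {e : K} (he : IsLiuSignElement K Φ e) :
    ∃ u : K, star u = u ∧ u ≠ 0 ∧ IsLiuSignElement K Φ' (u * e) ∧
      ∀ τ : K →+* ℂ, (τ u).re < 0 ↔ ¬ (τ ∈ Φ ↔ τ ∈ Φ') := by
  obtain ⟨u, hu, hu0, hsign⟩ := exists_real_of_cmTypes hΦ hΦ'
  refine ⟨u, hu, hu0, isLiuSignElement_mul_of_sign hΦ he hu hu0 hsign, fun τ => ?_⟩
  rw [← hsign τ]
  have hne := re_ne_zero_of_star_eq hu hu0 τ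
  constructor
  · intro h hpos
    exact absurd h (not_lt.mpr hpos.le)
  · intro h
    exact lt_of_le_of_ne (not_lt.mp h) hne

/-! ## 5. Lemma N.2 -/

/-- Two pairs of CM types have the same flip pattern: `Φ₁` and `Φ₁'` agree at `τ` iff `Φ₂` and
`Φ₂'` do.  For the datum's vertices this is `111 xor 101 = 100 xor 110`. -/
def SameFlip (Φ₁ Φ₁' Φ₂ Φ₂' : Set (K →+* ℂ)) : Prop :=
  ∀ τ : K →+* ℂ, (τ ∈ Φ₁ ↔ τ ∈ Φ₁') ↔ (τ ∈ Φ₂ ↔ τ ∈ Φ₂')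

/-- **Lemma N.2 (sign part), on the CM field.** Let `(Φ₁, Φ₁')` and `(Φ₂, Φ₂')` be two pairs of
CM types with the same flip pattern, `e₁` admissible for `Φ₁`, `e₂` admissible for `Φ₂`.  Then
there is a totally real `u ≠ 0` — negative exactly where `Φ₁` and `Φ₁'` differ — such that
`u e₁` is admissible for `Φ₁'`, `u⁻¹ e₂` is admissible for `Φ₂'`, and
`(u e₁)(u⁻¹ e₂) = e₁ e₂` exactly. -/
theorem lemma_N2 {Φ₁ Φ₁' Φ₂ Φ₂' : Set (K →+* ℂ)} (h₁ : IsCMType K Φ₁) (h₁' : IsCMType K Φ₁')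
    (h₂ : IsCMType K Φ₂) (hflip : SameFlip Φ₁ Φ₁' Φ₂ Φ₂') {e₁ e₂ : K}
    (he₁ : IsLiuSignElement K Φ₁ e₁) (he₂ : IsLiuSignElement K Φ₂ e₂) :
    ∃ u : K, star u = u ∧ u ≠ 0 ∧
      IsLiuSignElement K Φ₁' (u * e₁) ∧ IsLiuSignElement K Φ₂' (u⁻¹ * e₂) ∧
      (u * e₁) * (u⁻¹ * e₂) = e₁ * e₂ ∧
      ∀ τ : K →+* ℂ, (τ u).re < 0 ↔ ¬ (τ ∈ Φ₁ ↔ τ ∈ Φ₁') := by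
  obtain ⟨u, hu, hu0, hsign⟩ := exists_real_of_cmTypes h₁ h₁'
  have hsign₂ : ∀ τ : K →+* ℂ, 0 < (τ u⁻¹).re ↔ (τ ∈ Φ₂ ↔ τ ∈ Φ₂') := by
    intro τ
    rw [pos_re_inv_iff hu hu0, hsign τ]
    exact hflip τ
  refine ⟨u, hu, hu0, isLiuSignElement_mul_of_sign h₁ he₁ hu hu0 hsign,
    isLiuSignElement_mul_of_sign h₂ he₂ (star_inv_of_star_eq hu) (inv_ne_zero hu0) hsign₂,
    ?_, fun τ => ?_⟩
  · rw [mul_mul_mul_comm, mul_inv_cancel₀ hu0, one_mul]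
  · rw [← hsign τ]
    have hne := re_ne_zero_of_star_eq hu hu0 τ
    constructor
    · intro h hpos
      exact absurd h (not_lt.mpr hpos.le)
    · intro h
      exact lt_of_le_of_ne (not_lt.mp h) hne

end Summit.Ventures.HodgeRepro2.T5DatumCMField
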